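import Mathlib
import Summits.NavierStokesRegularity.OSWSelfSimilar.SheetNSLineTorusCascadeSynthesis
import Summits.NavierStokesRegularity.OSWSelfSimilar.SheetNSLineTorusCascadeGlobal
import HarnessLib

/-!
# Viscous CLM on the torus (`a = 0`, `σ = 2`): LOCAL CLASSICAL EXISTENCE for every sine datum — a windowed envelope
# (`[0, T₀]`) of a global cascade sums to a classical solution on `[0, T₀]`; `mode_le_sigmaOne` gives it for `T₀ < 2/c`

HONEST FRAMING (cell ns-blowup GROUP B «PROFILE SEARCH», zone Z3, row Z3-U addendum A-F2 of `HOME/profile/z3/CENSUS-Z3.md`;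
human rulings D-0035/D-0074): **1-D MODEL (viscous Constantin–Lax–Majda equation `ω_t = ω·Hω + ν ω_xx` on `𝕋`,
`H = hilbertTransformCircle`); series calculus, kernel-checked; not Euler, not Navier–Stokes; «violates: none — MODEL».**

WHY. `SheetNSLineTorusCascadeSynthesis` needs a GLOBAL-in-time geometric envelope and so yields classical solutions only
below the threshold. For the blow-up side (`c ≥ 48ν`: no classical solution on `[0, log 2/ν]`, `horizon_lt_log_two_div`) the
last print residue of clause (g2) was LOCAL existence: that a classical solution from `−c sin x` exists at all for a short
time. Here it becomes kernel for EVERY `c > 0`, `ν ≥ 0`: the global cascade (`cascadeSolution`, any datum) obeys the `σ = 1`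
majorant `c_k(t) ≤ c^k (t/2)^{k−1}` (`mode_le_sigmaOne`), a geometric envelope on every window `[0, T₀]` with `T₀ < 2/c`;
FREEZING the modes outside the window (`freeze T₀ e k s = e_k(clamp_{[0,T₀]} s)`) produces a family with a global envelope
to which the series calculus applies verbatim, and whose series solves the PDE on `(0, T₀)` where it is the true cascade.

* `freeze`, `abs_freeze_le` (the frozen family has a GLOBAL envelope), and the synthesis lemmas for the frozen family
  (`continuous_synthRhs_freeze`, `continuous_uncurry_synthOmega_freeze`, `continuous_uncurry_synthOmegaT_freeze`,
  `hilbert_synthOmega_freeze`, `synthOmega_mul_hilbert_freeze`, `synthOmegaT_eq_freeze` — the proofs of the cascade versions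
  verbatim; the frozen family is not a cascade, so they are re-run rather than cited); `hasDerivAt_synthOmega_t_freeze` (time derivative on `(0, T₀)` from the cascade (C)),
  **`isClassicalSolution_freeze`** (`IsClassicalSolution ν T₀` for the frozen series), `synthOmega_freeze_zero` (datum);
* **`exists_classicalSolution_of_window_envelope`** — a global sine cascade with an envelope on `[0, T₀]` gives a classical
  solution on `[0, T₀]` from `−c sin x`;
* **`exists_local_classicalSolution`** — for every `ν ≥ 0`, `c > 0` and every `0 < T₀ < 2/c` there is a classical solution on
  `[0, T₀]` from `−c sin x` (unique by `IsClassicalSolution.unique_of_sine`; for `c ≥ 48ν` it cannot be continued to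
  `[0, log 2/ν]` — finite-time loss of classical regularity ON THE MODEL, both halves kernel).

bears_on: LADDER-NS N5 / zone Z3 (row Z3-U, A-F2) → N1 linear core. WHAT THIS IS NOT: not NS; no statement about the maximal
existence time beyond `2/c ≤ T* ` and (for `c ≥ 48ν`) `T* ≤ log 2/ν`.
-/

noncomputable section

namespace Summit.NavierStokesRegularity.OSWSelfSimilar
namespace SheetNSLineTorusCascade

open Finset Real Set Filter MeasureTheory Complex
open Literature.Analysis.Fourier
open scoped Topology

/-! ### Freezing a cascade outside a window -/

/-- The modes frozen outside `[0, T₀]`: `freeze T₀ e k s = e_k(clamp_{[0,T₀]} s)`. [new here — MODEL] -/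
def freeze (T₀ : ℝ) (e : ℕ → ℝ → ℝ) : ℕ → ℝ → ℝ := fun k s => e k (max (min s T₀) 0)

section frozen

variable {ν c T₀ A q : ℝ} {e : ℕ → ℝ → ℝ} (he : IsSineCascade ν c e) (hT₀ : 0 < T₀) (hA : 0 ≤ A) (hq : 0 ≤ q)
  (hq1 : q < 1) (hbw : ∀ k : ℕ, ∀ t ∈ Icc (0 : ℝ) T₀, |e k t| ≤ A * k * q ^ k)
include he hT₀ hA hq hq1 hbw

omit he hA hq hq1 hbw in
/-- The clamp lands in the window. -/
theorem clamp_mem_Icc (s : ℝ) : max (min s T₀) 0 ∈ Icc (0 : ℝ) T₀ :=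
  ⟨le_max_right _ _, max_le (min_le_right _ _) hT₀.le⟩

omit hT₀ hA hq hq1 hbw in
/-- Mode `0` of the frozen family vanishes. -/
theorem freeze_zero : ∀ t : ℝ, freeze T₀ e 0 t = 0 := fun _ => he.zero _

omit hT₀ hA hq hq1 hbw in
/-- The frozen modes are continuous (after the outer clamp as well). -/
theorem continuous_freeze (k : ℕ) : Continuous fun t : ℝ => freeze T₀ e k (max t 0) := by
  unfold freeze
  exact (he.cont k).comp_continuous (f := fun t : ℝ => max (min (max t 0) T₀) 0) (by fun_prop)
    fun t => Set.mem_Ici.mpr (le_max_right _ _)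

omit he hA hq hq1 in
/-- The frozen family has a GLOBAL geometric envelope. -/
theorem abs_freeze_le : ∀ k : ℕ, ∀ t : ℝ, 0 ≤ t → |freeze T₀ e k t| ≤ A * k * q ^ k :=
  fun k t _ => hbw k _ (clamp_mem_Icc hT₀ t)

/-! ### The synthesis lemmas for the frozen family (same proofs as the cascade versions) -/
omit hT₀ hA hq hq1 hbw in
/-- Each `synthRhs k` is continuous on `ℝ` (generic family). -/
theorem continuous_synthRhs_freeze (k : ℕ) : Continuous (synthRhs ν (freeze T₀ e) k) := by
  unfold synthRhs
  refine (continuous_const.mul (continuous_finsetSum _ fun p _ => ?_)).sub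
    (continuous_const.mul (continuous_freeze he k))
  exact (continuous_freeze he p.1).mul (continuous_freeze he p.2)


/-- `ω` is jointly continuous on `ℝ × ℝ` (generic family). -/
theorem continuous_uncurry_synthOmega_freeze : Continuous (Function.uncurry (synthOmega (freeze T₀ e))) := by
  have h : Continuous fun p : ℝ × ℝ => ∑' k : ℕ, freeze T₀ e k (max p.1 0) * Real.sin ((k : ℝ) * p.2) :=
    continuous_tsum (u := majorant 0 A q) (fun k => ((continuous_freeze he k).comp continuous_fst).mul (by fun_prop))
      (summable_majorant 0 A hq hq1) fun k p => by rw [Real.norm_eq_abs]; exact abs_omega_term_le 0 hA hq (abs_freeze_le hT₀ hbw) k p.1 p.2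
  exact h.neg

/-- `ωt` is jointly continuous on `ℝ × ℝ` (generic family). -/
theorem continuous_uncurry_synthOmegaT_freeze : Continuous (Function.uncurry (synthOmegaT ν (freeze T₀ e))) := by
  have h : Continuous fun p : ℝ × ℝ => ∑' k : ℕ, synthRhs ν (freeze T₀ e) k p.1 * Real.sin ((k : ℝ) * p.2) :=
    continuous_tsum (u := majorant ν A q) (fun k => ((continuous_synthRhs_freeze he k).comp continuous_fst).mul (by fun_prop))
      (summable_majorant ν A hq hq1) fun k p => by rw [Real.norm_eq_abs]; exact abs_omegaT_term_le hA hq (abs_freeze_le hT₀ hbw) k p.1 p.2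
  exact h.neg


/-- **`H(ω(t,·))(x) = Σ_k e_k(t⁺) cos(kx)`** (termwise, `H sin k· = −cos k·`; the index is shifted by one because
`hilbertTransformCircle_tsum` counts frequencies from `1`) — generic family. [new here — MODEL] -/
theorem hilbert_synthOmega_freeze (t x : ℝ) :
    hilbertTransformCircle (synthOmega (freeze T₀ e) t) x = ∑' k : ℕ, freeze T₀ e k (max t 0) * Real.cos ((k : ℝ) * x) := by
  -- summability of the shifted coefficient weight `(k+1)·|e_{k+1}|`
  have hw : Summable fun k : ℕ => ((k : ℝ) + 1) * (|(-freeze T₀ e (k + 1) (max t 0))| + |(0 : ℝ)|) := by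
    have h1 : Summable fun k : ℕ => majorant 0 A q (k + 1) :=
      (summable_nat_add_iff 1).mpr (summable_majorant 0 A hq hq1)
    refine h1.of_nonneg_of_le (fun k => by positivity) fun k => ?_
    rw [abs_neg, abs_zero, add_zero]
    have hb' := abs_clamp_le (abs_freeze_le hT₀ hbw) (k + 1) t
    calc ((k : ℝ) + 1) * |freeze T₀ e (k + 1) (max t 0)| ≤ ((k : ℝ) + 1) * (A * (k + 1 : ℕ) * q ^ (k + 1)) := by
          gcongr
      _ ≤ majorant 0 A q (k + 1) := by
          unfold majorant
          push_cast
          have hqk : 0 ≤ q ^ (k + 1) := pow_nonneg hq _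
          have hC : A ≤ A + A ^ 2 / 12 + |(0:ℝ)| * A := by nlinarith [abs_nonneg (0:ℝ), sq_nonneg A]
          have hk1 : ((k : ℝ) + 1) * ((k : ℝ) + 1) ≤ ((k : ℝ) + 1) ^ 3 := by
            have : (1 : ℝ) ≤ (k : ℝ) + 1 := by linarith [Nat.cast_nonneg (α := ℝ) k]
            nlinarith
          calc ((k : ℝ) + 1) * (A * ((k : ℝ) + 1) * q ^ (k + 1)) = A * ((((k : ℝ) + 1) * ((k : ℝ) + 1)) * q ^ (k + 1)) := by
                ring
            _ ≤ (A + A ^ 2 / 12 + |(0:ℝ)| * A) * (((k : ℝ) + 1) ^ 3 * q ^ (k + 1)) := by gcongr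
  -- rewrite the slice as the shifted series
  have hsum0 : Summable fun k : ℕ => freeze T₀ e k (max t 0) * Real.sin ((k : ℝ) * x) :=
    (summable_majorant 0 A hq hq1).of_norm_bounded fun k => by
      rw [Real.norm_eq_abs]; exact abs_omega_term_le 0 hA hq (abs_freeze_le hT₀ hbw) k t x
  have hfun : synthOmega (freeze T₀ e) t = fun y => ∑' k : ℕ,
      ((-freeze T₀ e (k + 1) (max t 0)) * Real.sin (((k + 1 : ℕ) : ℝ) * y) + 0 * Real.cos (((k + 1 : ℕ) : ℝ) * y)) := by
    funext y
    unfold synthOmega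
    have hsy : Summable fun k : ℕ => freeze T₀ e k (max t 0) * Real.sin ((k : ℝ) * y) :=
      (summable_majorant 0 A hq hq1).of_norm_bounded fun k => by
        rw [Real.norm_eq_abs]; exact abs_omega_term_le 0 hA hq (abs_freeze_le hT₀ hbw) k t y
    rw [hsy.tsum_eq_zero_add]
    simp only [Nat.cast_zero, zero_mul, Real.sin_zero, mul_zero, zero_add, ← tsum_neg]
    refine tsum_congr fun k => ?_
    ring
  rw [hfun, hilbertTransformCircle_tsum hw x]
  -- shift back
  have hcos : Summable fun k : ℕ => freeze T₀ e k (max t 0) * Real.cos ((k : ℝ) * x) :=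
    (summable_majorant 0 A hq hq1).of_norm_bounded fun k => by
      rw [Real.norm_eq_abs]; exact abs_cos_term_le 0 hA hq (abs_freeze_le hT₀ hbw) k t x
  rw [hcos.tsum_eq_zero_add]
  simp only [Nat.cast_zero, zero_mul, Real.cos_zero, (freeze_zero he), mul_one, zero_add, neg_neg, zero_mul, add_zero]


/-- **`ω·Hω = −½ Σ_k (Σ_{i+j=k} e_i e_j) sin(kx)`** (at the clamped time): the analytic signal `z = Σ_k e_k e^{ikx}` has
`Re z = Hω`, `Im z = −ω`, `Im z² = 2 Re z Im z`, and `z²` is the Cauchy product of the series. [new here — MODEL] -/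
theorem synthOmega_mul_hilbert_freeze (t x : ℝ) :
    synthOmega (freeze T₀ e) t x * hilbertTransformCircle (synthOmega (freeze T₀ e) t) x
      = -(1 / 2) * ∑' k : ℕ, (∑ p ∈ antidiagonal k, freeze T₀ e p.1 (max t 0) * freeze T₀ e p.2 (max t 0)) * Real.sin ((k : ℝ) * x) := by
  rw [hilbert_synthOmega_freeze he hT₀ hA hq hq1 hbw t x]
  unfold synthOmega
  -- the analytic signal
  set a : ℕ → ℂ := fun k => ((freeze T₀ e k (max t 0) : ℝ) : ℂ) * Complex.exp ((((k : ℝ) * x : ℝ) : ℂ) * I) with ha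
  have hnorm : ∀ k, ‖a k‖ = |freeze T₀ e k (max t 0)| := fun k => by
    simp only [ha, norm_mul, Complex.norm_real, Real.norm_eq_abs, Complex.norm_exp_ofReal_mul_I, mul_one]
  have hsa : Summable fun k => ‖a k‖ := by
    refine (summable_majorant 0 A hq hq1).of_nonneg_of_le (fun k => norm_nonneg _) fun k => ?_
    rw [hnorm]
    have h := abs_cos_term_le 0 hA hq (abs_freeze_le hT₀ hbw) k t 0
    rwa [mul_zero, Real.cos_zero, mul_one] at h
  -- real and imaginary parts of the terms and of the square's terms
  have hre : ∀ k, (a k).re = freeze T₀ e k (max t 0) * Real.cos ((k : ℝ) * x) := fun k => by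
    simp only [ha, Complex.exp_ofReal_mul_I_re, Complex.re_ofReal_mul]
  have him : ∀ k, (a k).im = freeze T₀ e k (max t 0) * Real.sin ((k : ℝ) * x) := fun k => by
    simp only [ha, Complex.exp_ofReal_mul_I_im, Complex.im_ofReal_mul]
  set d : ℕ → ℝ := fun k => ∑ p ∈ antidiagonal k, freeze T₀ e p.1 (max t 0) * freeze T₀ e p.2 (max t 0) with hd
  have hsq_term : ∀ k, ∑ p ∈ antidiagonal k, a p.1 * a p.2
      = ((d k : ℝ) : ℂ) * Complex.exp ((((k : ℝ) * x : ℝ) : ℂ) * I) := by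
    intro k
    rw [hd]
    push_cast
    rw [sum_mul]
    refine sum_congr rfl fun p hp => ?_
    have hsum : p.1 + p.2 = k := mem_antidiagonal.mp hp
    simp only [ha]
    rw [mul_mul_mul_comm, ← Complex.exp_add, ← hsum]
    push_cast
    ring_nf
  -- the Cauchy product
  have hprod : (∑' k, a k) * (∑' k, a k) = ∑' k, ((d k : ℝ) : ℂ) * Complex.exp ((((k : ℝ) * x : ℝ) : ℂ) * I) := by
    rw [tsum_mul_tsum_eq_tsum_sum_antidiagonal_of_summable_norm hsa hsa]
    exact tsum_congr hsq_term
  -- summability of the square series (norm = |d k| ≤ A² k³ q^k)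
  have hsd : Summable fun k => ((d k : ℝ) : ℂ) * Complex.exp ((((k : ℝ) * x : ℝ) : ℂ) * I) := by
    refine Summable.of_norm ?_
    have h6 : Summable fun k : ℕ => A ^ 2 * ((k : ℝ) ^ 3 * q ^ k) :=
      (summable_pow_mul_geometric_of_norm_lt_one 3 (show ‖q‖ < 1 by rwa [Real.norm_of_nonneg hq])).mul_left _
    refine h6.of_nonneg_of_le (fun k => norm_nonneg _) fun k => ?_
    rw [norm_mul, Complex.norm_real, Complex.norm_exp_ofReal_mul_I, mul_one, Real.norm_eq_abs]
    have hqk : 0 ≤ q ^ k := pow_nonneg hq k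
    have hk0 : (0 : ℝ) ≤ k := Nat.cast_nonneg k
    have hk3 : (0 : ℝ) ≤ (k : ℝ) ^ 3 := by positivity
    have hdiv : ((k : ℝ) ^ 3 - k) / 6 ≤ (k : ℝ) ^ 3 := by linarith
    calc |d k| ≤ A ^ 2 * q ^ k * (((k : ℝ) ^ 3 - k) / 6) := abs_conv_le hA hq (abs_freeze_le hT₀ hbw) k t
      _ ≤ A ^ 2 * q ^ k * (k : ℝ) ^ 3 := mul_le_mul_of_nonneg_left hdiv (by positivity)
      _ = A ^ 2 * ((k : ℝ) ^ 3 * q ^ k) := by ring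
  -- take imaginary parts
  have hsa' : Summable a := hsa.of_norm
  have hIm_z : (∑' k, a k).im = ∑' k, freeze T₀ e k (max t 0) * Real.sin ((k : ℝ) * x) := by
    rw [show (∑' k, a k).im = Complex.imCLM (∑' k, a k) from rfl, ContinuousLinearMap.map_tsum _ hsa']
    exact tsum_congr fun k => by rw [Complex.imCLM_apply, him]
  have hRe_z : (∑' k, a k).re = ∑' k, freeze T₀ e k (max t 0) * Real.cos ((k : ℝ) * x) := by
    rw [show (∑' k, a k).re = Complex.reCLM (∑' k, a k) from rfl, ContinuousLinearMap.map_tsum _ hsa']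
    exact tsum_congr fun k => by rw [Complex.reCLM_apply, hre]
  have hIm_sq : ((∑' k, a k) * (∑' k, a k)).im = ∑' k, d k * Real.sin ((k : ℝ) * x) := by
    rw [hprod, show (∑' k, ((d k : ℝ) : ℂ) * Complex.exp ((((k : ℝ) * x : ℝ) : ℂ) * I)).im
      = Complex.imCLM (∑' k, ((d k : ℝ) : ℂ) * Complex.exp ((((k : ℝ) * x : ℝ) : ℂ) * I)) from rfl,
      ContinuousLinearMap.map_tsum _ hsd]
    exact tsum_congr fun k => by
      rw [Complex.imCLM_apply]; simp only [Complex.exp_ofReal_mul_I_im, Complex.im_ofReal_mul]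
  have hkey : ((∑' k, a k) * (∑' k, a k)).im = 2 * ((∑' k, a k).re * (∑' k, a k).im) := by
    rw [Complex.mul_im]; ring
  rw [hIm_z, hRe_z, hIm_sq] at hkey
  -- conclude
  have hfin : (∑' k, freeze T₀ e k (max t 0) * Real.sin ((k : ℝ) * x)) * (∑' k, freeze T₀ e k (max t 0) * Real.cos ((k : ℝ) * x))
      = (1 / 2) * ∑' k, d k * Real.sin ((k : ℝ) * x) := by
    linear_combination (-(1 / 2) : ℝ) * hkey
  rw [neg_mul, hfin]
  ring


/-- **The equation `ωt = ω·Hω + ν ωxx` holds pointwise** (every real `t`, with the clamped modes; in particular on `t ≥ 0`).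
[new here — MODEL] -/
theorem synthOmegaT_eq_freeze (t x : ℝ) :
    synthOmegaT ν (freeze T₀ e) t x = synthOmega (freeze T₀ e) t x * hilbertTransformCircle (synthOmega (freeze T₀ e) t) x + ν * synthOmegaXX (freeze T₀ e) t x := by
  rw [synthOmega_mul_hilbert_freeze he hT₀ hA hq hq1 hbw t x]
  unfold synthOmegaT synthOmegaXX synthRhs
  have hs1 := summable_conv_sin hA hq hq1 (abs_freeze_le hT₀ hbw) t x
  have hs2 : Summable fun k : ℕ => freeze T₀ e k (max t 0) * ((k : ℝ) ^ 2 * Real.sin ((k : ℝ) * x)) :=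
    (summable_majorant 0 A hq hq1).of_norm_bounded fun k => by
      rw [Real.norm_eq_abs]; exact abs_omegaXX_term_le 0 hA hq (abs_freeze_le hT₀ hbw) k t x
  have hsplit : (fun k : ℕ => (1 / 2 * (∑ p ∈ antidiagonal k, freeze T₀ e p.1 (max t 0) * freeze T₀ e p.2 (max t 0))
      - ν * (k : ℝ) ^ 2 * freeze T₀ e k (max t 0)) * Real.sin ((k : ℝ) * x))
      = fun k => (1 / 2) * ((∑ p ∈ antidiagonal k, freeze T₀ e p.1 (max t 0) * freeze T₀ e p.2 (max t 0)) * Real.sin ((k : ℝ) * x))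
        - ν * (freeze T₀ e k (max t 0) * ((k : ℝ) ^ 2 * Real.sin ((k : ℝ) * x))) := by
    funext k; ring
  rw [hsplit, (hs1.mul_left (1 / 2)).tsum_sub (hs2.mul_left ν), tsum_mul_left, tsum_mul_left]
  ring

/-- **Time derivative of the frozen series on `(0, T₀)`** — there the frozen modes ARE the cascade. [new here — MODEL] -/
theorem hasDerivAt_synthOmega_t_freeze {t : ℝ} (ht : t ∈ Ioo (0 : ℝ) T₀) (x : ℝ) :
    HasDerivAt (fun s => synthOmega (freeze T₀ e) s x) (synthOmegaT ν (freeze T₀ e) t x) t := by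
  unfold synthOmega synthOmegaT
  have h := hasDerivAt_tsum_of_isPreconnected (u := majorant ν A q) (t := Ioo (0 : ℝ) T₀)
    (g := fun (k : ℕ) (s : ℝ) => freeze T₀ e k (max s 0) * Real.sin ((k : ℝ) * x))
    (g' := fun (k : ℕ) (s : ℝ) => synthRhs ν (freeze T₀ e) k s * Real.sin ((k : ℝ) * x)) (y₀ := T₀ / 2)
    (summable_majorant ν A hq hq1) isOpen_Ioo isPreconnected_Ioo (fun k s hs => ?_) (fun k s _ => ?_)
    (by constructor <;> linarith) ?_ ht
  · exact h.neg
  · have heq : (fun r : ℝ => freeze T₀ e k (max r 0)) =ᶠ[𝓝 s] e k := by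
      filter_upwards [Ioo_mem_nhds hs.1 hs.2] with r hr
      simp only [freeze]
      rw [max_eq_left hr.1.le, min_eq_left hr.2.le, max_eq_left hr.1.le]
    have h1 : HasDerivAt (fun r : ℝ => freeze T₀ e k (max r 0))
        ((1 / 2) * (∑ p ∈ antidiagonal k, e p.1 s * e p.2 s) - ν * (k : ℝ) ^ 2 * e k s) s :=
      (he.ode k s hs.1).congr_of_eventuallyEq heq
    have h2 := h1.mul_const (Real.sin ((k : ℝ) * x))
    refine h2.congr_deriv ?_
    simp only [synthRhs, freeze, max_eq_left hs.1.le, min_eq_left hs.2.le]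
  · rw [Real.norm_eq_abs]; exact abs_omegaT_term_le hA hq (abs_freeze_le hT₀ hbw) k s x
  · exact (summable_majorant ν A hq hq1).of_norm_bounded (fun k => by
      rw [Real.norm_eq_abs]; exact abs_omega_term_le ν hA hq (abs_freeze_le hT₀ hbw) k (T₀ / 2) x)

/-- **The frozen series is a classical solution on `[0, T₀]`.** [new here — MODEL] -/
theorem isClassicalSolution_freeze :
    IsClassicalSolution ν T₀ (synthOmega (freeze T₀ e)) (synthOmegaT ν (freeze T₀ e))
      (synthOmegaX (freeze T₀ e)) (synthOmegaXX (freeze T₀ e)) where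
  periodic t _ := synthOmega_periodic t
  hasDeriv_x t _ x := hasDerivAt_synthOmega_x hA hq hq1 (abs_freeze_le hT₀ hbw) t x
  hasDeriv_xx t _ x := hasDerivAt_synthOmegaX_x hA hq hq1 (abs_freeze_le hT₀ hbw) t x
  cont_xx t _ := continuous_synthOmegaXX hA hq hq1 (abs_freeze_le hT₀ hbw) t
  cont := (continuous_uncurry_synthOmega_freeze he hT₀ hA hq hq1 hbw).continuousOn
  hasDeriv_t _ ht x := hasDerivAt_synthOmega_t_freeze he hT₀ hA hq hq1 hbw ht x
  cont_t := (continuous_uncurry_synthOmegaT_freeze he hT₀ hA hq hq1 hbw).continuousOn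
  pde t _ x := synthOmegaT_eq_freeze he hT₀ hA hq hq1 hbw t x

omit hA hq hq1 hbw in
/-- The datum of the frozen series is `−c sin x`. [new here — MODEL] -/
theorem synthOmega_freeze_zero (x : ℝ) : synthOmega (freeze T₀ e) 0 x = -c * Real.sin x := by
  unfold synthOmega freeze
  rw [max_self, min_eq_left hT₀.le, max_self, tsum_eq_single 1]
  · rw [he.one_init, Nat.cast_one, one_mul, neg_mul]
  · intro k hk
    rcases Nat.lt_or_ge k 2 with h | h
    · interval_cases k
      · rw [he.zero, zero_mul]
      · exact absurd rfl hk
    · rw [he.init_zero k h, zero_mul]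

/-- **A windowed envelope gives a classical solution on the window.** [new here — MODEL] -/
theorem exists_classicalSolution_of_window_envelope :
    ∃ ω ωt ωx ωxx : ℝ → ℝ → ℝ, (∀ x, ω 0 x = -c * Real.sin x) ∧ IsClassicalSolution ν T₀ ω ωt ωx ωxx :=
  ⟨_, _, _, _, synthOmega_freeze_zero he hT₀, isClassicalSolution_freeze he hT₀ hA hq hq1 hbw⟩

end frozen

/-! ### Local existence for every sine datum -/

/-- The `σ = 1` majorant as a windowed geometric envelope: for the sine cascade (`ν ≥ 0`, `c ≥ 0`) and `T₀ > 0`,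
`|c_k(t)| ≤ (2/T₀)·k·(cT₀/2)^k` on `[0, T₀]`. [new here — MODEL] -/
theorem abs_le_window_envelope {ν c : ℝ} {e : ℕ → ℝ → ℝ} (he : IsSineCascade ν c e) (hν : 0 ≤ ν) (hc : 0 ≤ c)
    {T₀ : ℝ} (hT₀ : 0 < T₀) : ∀ k : ℕ, ∀ t ∈ Icc (0 : ℝ) T₀, |e k t| ≤ 2 / T₀ * k * (c * T₀ / 2) ^ k := by
  intro k t ht
  rw [abs_of_nonneg (nonneg he hc k t ht.1)]
  rcases Nat.eq_zero_or_pos k with hk | hk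
  · rw [hk, he.zero]; simp
  · have h1 := mode_le_sigmaOne he hν hc k hk t ht.1
    have hexp : Real.exp (-(ν * (k : ℝ) * t)) ≤ 1 := by
      rw [Real.exp_le_one_iff]
      have : 0 ≤ ν * (k : ℝ) * t := by have := ht.1; positivity
      linarith
    have hpow : (t / 2) ^ (k - 1) ≤ (T₀ / 2) ^ (k - 1) :=
      pow_le_pow_left₀ (by linarith [ht.1]) (by linarith [ht.2]) _
    have hck : 0 ≤ c ^ k := pow_nonneg hc k
    obtain ⟨m, rfl⟩ : ∃ m, k = m + 1 := ⟨k - 1, by omega⟩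
    simp only [Nat.add_sub_cancel] at h1 hpow
    have hk1 : (1 : ℝ) ≤ ((m + 1 : ℕ) : ℝ) := by exact_mod_cast hk
    calc e (m + 1) t ≤ c ^ (m + 1) * (t / 2) ^ m * Real.exp (-(ν * ((m + 1 : ℕ) : ℝ) * t)) := h1
      _ ≤ c ^ (m + 1) * (T₀ / 2) ^ m * 1 := by
          gcongr
      _ = 2 / T₀ * 1 * (c * T₀ / 2) ^ (m + 1) := by
          have hT0 : T₀ ≠ 0 := hT₀.ne'
          field_simp
          ring
      _ ≤ 2 / T₀ * ((m + 1 : ℕ) : ℝ) * (c * T₀ / 2) ^ (m + 1) := by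
          have hq0 : 0 ≤ (c * T₀ / 2) ^ (m + 1) := by positivity
          gcongr

/-- **LOCAL CLASSICAL EXISTENCE FOR EVERY SINE DATUM.** For `ν ≥ 0`, `c > 0` and every horizon `0 < T₀ < 2/c` there is a
classical solution of `ω_t = ω·Hω + ν ω_xx` on `[0, T₀] × ℝ` with `ω(0,·) = −c sin` (the frozen series of the explicit cascade
`cascadeSolution ν (sineDatum c)`); it is the unique one (`IsClassicalSolution.unique_of_sine`), and for `0 < ν`, `c ≥ 48ν`
no classical solution exists on `[0, log 2/ν]` (`horizon_lt_log_two_div`) — finite-time loss of classical regularity ON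
THE MODEL. [new here — MODEL] -/
theorem exists_local_classicalSolution {ν c : ℝ} (hν : 0 ≤ ν) (hc : 0 < c) {T₀ : ℝ} (hT₀ : 0 < T₀) (hT : T₀ < 2 / c) :
    ∃ ω ωt ωx ωxx : ℝ → ℝ → ℝ, (∀ x, ω 0 x = -c * Real.sin x) ∧ IsClassicalSolution ν T₀ ω ωt ωx ωxx := by
  have he := isSineCascade_cascadeSolution ν c
  have hq1 : c * T₀ / 2 < 1 := by
    rw [lt_div_iff₀ hc] at hT
    linarith
  exact exists_classicalSolution_of_window_envelope he hT₀ (by positivity) (by positivity) hq1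
    (abs_le_window_envelope he hν hc.le hT₀)

end SheetNSLineTorusCascade
end Summit.NavierStokesRegularity.OSWSelfSimilar
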